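import Summits.RiemannHypothesis.RiemannHypothesis.Theorems.SoninCertBSplit
import HarnessLib

/-!
# Sonin-space certificate at `b = 107/200`, P4-C: inclusion theorems for the interval lists of `SoninCertBKernel`

Cell `rh-explicit`, seat cc-s2-3, Phase 2 (lead R7-12/R7-12a).  The kernel file evaluates the closed forms of P4-B in
the tree's outward-rounded fixed-point engine `NumericsMP.MI` (scale `S4 = 2^192`) through small list combinators
(`addI`, `smulI`, `mulI`, `affCompI`, `momI`, `momGI`, `powList`, `npow`, `epow`, `taylorI`, `sumI`, `mulFracI`, `ofQI`).
This file proves, combinator by combinator, that the real quantities they mirror are MEMBERS of the computed intervals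
(structural inductions over `MI.mem_add/mem_mul/…`): the rational list `affComp c h l` lies in `affCompI`, the partial
moments `∫_{−1}^{a} s^k κ̂(s) ds` lie in `momI`/`momGI`, the nested Taylor sum `Σ_m x^m/m!·mom_m` lies in `taylorI`,
`e^{q b/2}` lies in `epow`, finite sums lie in `sumI`.  Proof-only file (`taylorR`, the real nested Taylor sum, is defined in P4-A).  No facts, no axioms; nothing about `ζ`.
-/

set_option linter.dupNamespace false  -- the mandated namespace repeats `RiemannHypothesis`

noncomputable section

open MeasureTheory Set Finset
open Summit.RiemannHypothesis.RiemannHypothesis.Theorems.SemilocalPolyWitness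
open Literature.Analysis.ValidatedNumerics Literature.Analysis.ValidatedNumerics.NumericsMP

namespace Summit.RiemannHypothesis.RiemannHypothesis.SoninCert

/-! ## Scalars -/

/-- `0 < S4`. [folklore] -/
theorem S4_pos : 0 < S4 := by unfold S4; norm_num

/-- `0 ∈ zI`. [folklore] -/
theorem mem_zI : MI.mem S4 (0 : ℝ) zI := by
  simp [MI.mem, zI]

/-- `x ∈ ofQI x`. [folklore] -/
theorem mem_ofQI (x : ℚ) : MI.mem S4 (x : ℝ) (ofQI x) := by
  have h := MI.mem_ofFrac S4 x.num (q := x.den) x.pos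
  rw [Rat.cast_def]
  exact h

/-- `x·q ∈ mulFracI I q` for `x ∈ I`. [folklore] -/
theorem mem_mulFracI {x : ℝ} {I : MI} (hx : MI.mem S4 x I) (q : ℚ) : MI.mem S4 (x * (q : ℝ)) (mulFracI I q) := by
  have h := MI.mem_divNat (MI.mem_mulInt hx q.num) q.pos
  rw [mulFracI, Rat.cast_def, show x * ((q.num : ℝ) / (q.den : ℝ)) = x * (q.num : ℝ) / (q.den : ℕ) by ring]
  exact h

/-- A cast rational times an interval member: `(q:ℝ)·x ∈ mulFracI I q`. [folklore] -/
theorem mem_mulFracI' {x : ℝ} {I : MI} (hx : MI.mem S4 x I) (q : ℚ) : MI.mem S4 ((q : ℝ) * x) (mulFracI I q) := by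
  rw [mul_comm]; exact mem_mulFracI hx q

/-- Finite sums over `range n` lie in `sumI` of the mapped list. [folklore] -/
theorem mem_sumI_range : ∀ (n : ℕ) {f : ℕ → ℝ} {F : ℕ → MI}, (∀ i < n, MI.mem S4 (f i) (F i)) →
    MI.mem S4 (∑ i ∈ range n, f i) (sumI ((List.range n).map F))
  | 0, _, _, _ => by simpa [sumI] using mem_zI
  | n + 1, f, F, h => by
      rw [List.range_succ_eq_map, List.map_cons, List.map_map, sumI, Finset.sum_range_succ', add_comm]
      exact MI.mem_add (h 0 (Nat.succ_pos n)) (mem_sumI_range n (f := f ∘ Nat.succ) (F := F ∘ Nat.succ)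
        fun i hi => h (i + 1) (Nat.succ_lt_succ hi))

/-! ## Entrywise membership of rational lists in interval lists -/

/-! Entrywise membership of a rational list `l` in an interval list `L` is written
`List.Forall₂ (fun (q : ℚ) (I : MI) => MI.mem S4 (q : ℝ) I) l L` throughout (no abbreviation, no notation). -/

/-- `l ∈ l.map ofQI`. [folklore] -/
theorem lmem_map_ofQI (l : List ℚ) : List.Forall₂ (fun (q : ℚ) (I : MI) => MI.mem S4 (q : ℝ) I) l (l.map ofQI) := by
  rw [List.forall₂_map_right_iff]
  exact List.forall₂_same.2 fun x _ => mem_ofQI x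

/-- `LQ.add` lies in `addI`. [folklore] -/
theorem lmem_addI {p q : List ℚ} {P Q : List MI} (hp : List.Forall₂ (fun (q : ℚ) (I : MI) => MI.mem S4 (q : ℝ) I) p P) (hq : List.Forall₂ (fun (q : ℚ) (I : MI) => MI.mem S4 (q : ℝ) I) q Q) : List.Forall₂ (fun (q : ℚ) (I : MI) => MI.mem S4 (q : ℝ) I) (LQ.add p q) (addI P Q) := by
  induction hp generalizing q Q with
  | nil => exact hq
  | cons ha _ ih =>
      cases hq with
      | nil => exact List.Forall₂.cons ha ‹_›
      | cons hb hq' =>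
          refine List.Forall₂.cons ?_ (ih hq')
          push_cast; exact MI.mem_add ha hb

/-- `LQ.smul c` lies in `smulI C` for `c ∈ C`. [folklore] -/
theorem lmem_smulI {c : ℚ} {C : MI} (hc : MI.mem S4 (c : ℝ) C) :
    ∀ {q : List ℚ} {Q : List MI}, List.Forall₂ (fun (q : ℚ) (I : MI) => MI.mem S4 (q : ℝ) I) q Q → List.Forall₂ (fun (q : ℚ) (I : MI) => MI.mem S4 (q : ℝ) I) (LQ.smul c q) (smulI C Q)
  | [], _, h => by cases h; exact List.Forall₂.nil
  | _ :: _, _, h => by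
      cases h with
      | cons hb h' =>
          simp only [LQ.smul, smulI, List.map_cons]
          refine List.Forall₂.cons ?_ (lmem_smulI hc h')
          push_cast; exact MI.mem_mul S4_pos hc hb

/-- `LQ.mul` lies in `mulI`. [folklore] -/
theorem lmem_mulI : ∀ {p q : List ℚ} {P Q : List MI}, List.Forall₂ (fun (q : ℚ) (I : MI) => MI.mem S4 (q : ℝ) I) p P → List.Forall₂ (fun (q : ℚ) (I : MI) => MI.mem S4 (q : ℝ) I) q Q → List.Forall₂ (fun (q : ℚ) (I : MI) => MI.mem S4 (q : ℝ) I) (LQ.mul p q) (mulI P Q)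
  | [], _, _, _, hp, _ => by cases hp; exact List.Forall₂.nil
  | _ :: _, _, _, _, hp, hq => by
      cases hp with
      | cons ha hp' =>
          simp only [LQ.mul, mulI]
          refine lmem_addI (lmem_smulI ha hq) ?_
          refine List.Forall₂.cons ?_ (lmem_mulI hp' hq)
          push_cast; exact mem_zI

/-- `affComp c h l` lies in `affCompI C H L`. [folklore] -/
theorem lmem_affCompI {c h : ℚ} {C H : MI} (hc : MI.mem S4 (c : ℝ) C) (hh : MI.mem S4 (h : ℝ) H) :
    ∀ {l : List ℚ} {L : List MI}, List.Forall₂ (fun (q : ℚ) (I : MI) => MI.mem S4 (q : ℝ) I) l L → List.Forall₂ (fun (q : ℚ) (I : MI) => MI.mem S4 (q : ℝ) I) (affComp c h l) (affCompI C H L)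
  | [], _, hl => by cases hl; exact List.Forall₂.nil
  | _ :: _, _, hl => by
      cases hl with
      | cons ha hl' =>
          simp only [affComp, affCompI]
          exact lmem_addI (List.Forall₂.cons ha List.Forall₂.nil)
            (lmem_mulI (List.Forall₂.cons hc (List.Forall₂.cons hh List.Forall₂.nil)) (lmem_affCompI hc hh hl'))

/-- `ev (affComp c h l) s = ev l (c + h s)`. [folklore] -/
theorem ev_affComp (c h : ℚ) : ∀ (l : List ℚ) (s : ℝ), LQ.ev (affComp c h l) s = LQ.ev l ((c : ℝ) + (h : ℝ) * s)
  | [], s => by simp [affComp]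
  | a :: as, s => by
      rw [affComp, LQ.ev_add, LQ.ev_mul, ev_affComp c h as s, LQ.ev_cons]
      simp only [LQ.ev_cons, LQ.ev_nil]
      ring

/-- **`κ̂ ∈ khatI`** (the recentred autocorrelation list). [folklore] -/
theorem lmem_khatI : List.Forall₂ (fun (q : ℚ) (I : MI) => MI.mem S4 (q : ℝ) I) khatQ khatI :=
  lmem_affCompI (mem_ofQI bQ) (mem_ofQI bQ) (lmem_map_ofQI kapLit)

/-- `κ̂(s) = κ(b + b s)`. [folklore] -/
theorem ev_khatQ (s : ℝ) : LQ.ev khatQ s = LQ.ev kapLit ((bQ : ℝ) + (bQ : ℝ) * s) := ev_affComp bQ bQ kapLit s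

/-! ## Powers and exponentials -/

/-- `y^n ∈ npow Y n`. [folklore] -/
theorem mem_npow {y : ℝ} {Y : MI} (hy : MI.mem S4 y Y) : ∀ n : ℕ, MI.mem S4 (y ^ n) (npow Y n)
  | 0 => by simpa [npow] using MI.mem_ofInt S4 1
  | n + 1 => by rw [npow, pow_succ]; exact MI.mem_mul S4_pos (mem_npow hy n) hy

/-- `e^{q·107/400} ∈ epow e e' q` when `e ∋ e^{107/400}`, `e' ∋ e^{−107/400}`. [folklore] -/
theorem mem_epow {e e' : MI} (he : MI.mem S4 (Real.exp (107 / 400)) e) (he' : MI.mem S4 (Real.exp (-(107 / 400))) e')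
    (q : ℤ) : MI.mem S4 (Real.exp ((q : ℝ) * (107 / 400))) (epow e e' q) := by
  unfold epow
  split_ifs with hq
  · have h := mem_npow he q.toNat
    rw [← Real.exp_nat_mul, show ((q.toNat : ℕ) : ℝ) = (q : ℝ) by exact_mod_cast Int.toNat_of_nonneg hq] at h
    exact h
  · have h := mem_npow he' (-q).toNat
    have hz : (((-q).toNat : ℕ) : ℤ) = -q := Int.toNat_of_nonneg (by omega)
    have hr : (((-q).toNat : ℕ) : ℝ) = -(q : ℝ) := by exact_mod_cast hz
    rw [← Real.exp_nat_mul, hr, show -(q : ℝ) * -(107 / 400 : ℝ) = (q : ℝ) * (107 / 400) by ring] at h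
    exact h

/-- `c·x^j ∈ (powList X n C)[j]` for `j < n`. [folklore] -/
theorem mem_powList {x : ℝ} {X : MI} (hx : MI.mem S4 x X) :
    ∀ (n : ℕ) {c : ℝ} {C : MI}, MI.mem S4 c C → ∀ j < n, MI.mem S4 (c * x ^ j) ((powList X n C).getD j zI)
  | 0, _, _, _, j, hj => absurd hj (Nat.not_lt_zero j)
  | n + 1, c, C, hc, 0, _ => by simpa [powList] using hc
  | n + 1, c, C, hc, j + 1, hj => by
      rw [powList, List.getD_cons_succ, pow_succ', ← mul_assoc]
      exact mem_powList hx n (MI.mem_mul S4_pos hc hx) j (Nat.lt_of_succ_lt_succ hj)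

/-! ## Moments `∫_{−1}^{a} s^k l(s) ds` -/

/-- One Horner step under the moment integral. [folklore] -/
theorem integral_pow_mul_ev_cons (c : ℚ) (cs : List ℚ) (a : ℝ) (k : ℕ) :
    ∫ s in (-1 : ℝ)..a, s ^ k * LQ.ev (c :: cs) s
      = (c : ℝ) * ((a ^ (k + 1) - (-1) ^ (k + 1)) / (k + 1)) + ∫ s in (-1 : ℝ)..a, s ^ (k + 1) * LQ.ev cs s := by
  have h1 : (fun s : ℝ => s ^ k * LQ.ev (c :: cs) s) = fun s => (c : ℝ) * s ^ k + s ^ (k + 1) * LQ.ev cs s := by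
    funext s; rw [LQ.ev_cons]; ring
  have i1 : IntervalIntegrable (fun s : ℝ => (c : ℝ) * s ^ k) volume (-1 : ℝ) a :=
    (continuous_const.mul (continuous_pow k)).intervalIntegrable _ _
  have i2 : IntervalIntegrable (fun s : ℝ => s ^ (k + 1) * LQ.ev cs s) volume (-1 : ℝ) a :=
    ((continuous_pow (k + 1)).mul (LQ.continuous_ev cs)).intervalIntegrable _ _
  rw [h1, intervalIntegral.integral_add i1 i2, intervalIntegral.integral_const_mul, integral_pow]

/-- **`∫_{−1}^{1} s^k l(s) ds ∈ momI L k`** for `l ∈ L`. [folklore] -/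
theorem mem_momI : ∀ {l : List ℚ} {L : List MI}, List.Forall₂ (fun (q : ℚ) (I : MI) => MI.mem S4 (q : ℝ) I) l L → ∀ k : ℕ,
    MI.mem S4 (∫ s in (-1 : ℝ)..1, s ^ k * LQ.ev l s) (momI L k)
  | [], _, h, k => by cases h; simpa [momI] using mem_zI
  | c :: cs, _, h, k => by
      cases h with
      | cons hc h' =>
          rw [integral_pow_mul_ev_cons, momI]
          refine MI.mem_add ?_ (mem_momI h' (k + 1))
          split_ifs with hk
          · have hodd : Odd (k + 1) := by rw [Nat.odd_iff]; omega
            rw [hodd.neg_one_pow, one_pow, show (c : ℝ) * ((1 - -1) / (k + 1)) = (c : ℝ) * (2 : ℤ) / ((k + 1 : ℕ) : ℝ) by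
              push_cast; ring]
            exact MI.mem_divNat (MI.mem_mulInt hc 2) (Nat.succ_pos k)
          · have hev : Even (k + 1) := by rw [Nat.even_iff]; omega
            rw [hev.neg_one_pow, one_pow, sub_self, zero_div, mul_zero]
            exact mem_zI

/-- **`∫_{−1}^{a} s^k l(s) ds ∈ momGI ap L k`** when `ap[j] ∋ a^j` for the needed `j`. [folklore] -/
theorem mem_momGI {a : ℝ} {ap : List MI} {N : ℕ} (hap : ∀ j, j ≤ N → MI.mem S4 (a ^ j) (ap.getD j zI)) :
    ∀ {l : List ℚ} {L : List MI}, List.Forall₂ (fun (q : ℚ) (I : MI) => MI.mem S4 (q : ℝ) I) l L → ∀ k : ℕ, l.length + k ≤ N →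
      MI.mem S4 (∫ s in (-1 : ℝ)..a, s ^ k * LQ.ev l s) (momGI ap L k)
  | [], _, h, k, _ => by cases h; simpa [momGI] using mem_zI
  | c :: cs, _, h, k, hk => by
      cases h with
      | cons hc h' =>
          rw [integral_pow_mul_ev_cons, momGI]
          refine MI.mem_add ?_ (mem_momGI hap h' (k + 1) (by simp only [List.length_cons] at hk; omega))
          rw [show (c : ℝ) * ((a ^ (k + 1) - (-1) ^ (k + 1)) / (k + 1))
            = (c : ℝ) * (a ^ (k + 1) - (((-1) ^ (k + 1) : ℤ) : ℝ)) / ((k + 1 : ℕ) : ℝ) by push_cast; ring]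
          exact MI.mem_divNat (MI.mem_mul S4_pos hc (MI.mem_sub (hap (k + 1)
            (by simp only [List.length_cons] at hk; omega)) (MI.mem_ofInt S4 _))) (Nat.succ_pos k)

/-! ## The nested Taylor sum -/

/-- The nested sum is the Taylor-weighted sum: `taylorR x f n m = Σ_{j<n} f(m+j) x^j m!/(m+j)!`. [folklore] -/
theorem taylorR_eq_sum (x : ℝ) (f : ℕ → ℝ) : ∀ n m : ℕ,
    taylorR x f n m = ∑ j ∈ range n, f (m + j) * x ^ j * ((m.factorial : ℝ) / ((m + j).factorial : ℝ))
  | 0, m => by simp [taylorR]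
  | n + 1, m => by
      rw [taylorR, taylorR_eq_sum x f n (m + 1), Finset.sum_range_succ', Finset.mul_sum]
      simp only [add_zero, pow_zero, mul_one]
      rw [div_self (by positivity), mul_one, add_comm]
      congr 1
      refine Finset.sum_congr rfl fun j _ => ?_
      rw [show m + 1 + j = m + (j + 1) by ring, Nat.factorial_succ m]
      have h1 : ((m + (j + 1)).factorial : ℝ) ≠ 0 := by positivity
      have h2 : ((m : ℝ) + 1) ≠ 0 := by positivity
      field_simp
      push_cast
      ring

/-- At `m = 0`: `taylorR x f n 0 = Σ_{j<n} f j x^j / j!`. [folklore] -/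
theorem taylorR_zero (x : ℝ) (f : ℕ → ℝ) (n : ℕ) :
    taylorR x f n 0 = ∑ j ∈ range n, x ^ j / (j.factorial : ℝ) * f j := by
  rw [taylorR_eq_sum]
  refine Finset.sum_congr rfl fun j _ => ?_
  rw [zero_add, Nat.factorial_zero, Nat.cast_one]; ring

/-- **`taylorR (q·107/400) f |L| m ∈ taylorI q L m`** when `L[i] ∋ f(m+i)`. [folklore] -/
theorem mem_taylorI (q : ℤ) {f : ℕ → ℝ} : ∀ (L : List MI) (m : ℕ),
    (∀ i < L.length, MI.mem S4 (f (m + i)) (L.getD i zI)) →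
      MI.mem S4 (taylorR ((q : ℝ) * 107 / 400) f L.length m) (taylorI q L m)
  | [], m, _ => by simpa [taylorR, taylorI] using mem_zI
  | A :: As, m, h => by
      rw [List.length_cons, taylorR, taylorI]
      have h0 : MI.mem S4 (f m) A := by simpa using h 0 (Nat.succ_pos _)
      have ih := mem_taylorI q As (m + 1) fun i hi => by
        simpa [Nat.add_assoc, Nat.add_comm 1 i] using h (i + 1) (Nat.succ_lt_succ hi)
      refine MI.mem_add h0 ?_
      have h2 := MI.mem_divNat (MI.mem_mulInt ih (q * 107)) (n := 400 * (m + 1)) (by positivity)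
      have e : (q : ℝ) * 107 / 400 / (m + 1) * taylorR ((q : ℝ) * 107 / 400) f As.length (m + 1)
          = taylorR ((q : ℝ) * 107 / 400) f As.length (m + 1) * ((q * 107 : ℤ) : ℝ) / ((400 * (m + 1) : ℕ) : ℝ) := by
        have hm : ((m : ℝ) + 1) ≠ 0 := by positivity
        push_cast
        field_simp
      rw [e]
      exact h2

end Summit.RiemannHypothesis.RiemannHypothesis.SoninCert
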